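import Mathlib
import HarnessLib
import Summits.NavierStokesRegularity.NavierStokesRegularity.Theorems.PoloidalWindowDoorPoloidalWindowRigidityLrcJetKernel
import Summits.NavierStokesRegularity.NavierStokesRegularity.Theorems.PoloidalWindowDoorPoloidalWindowRigidityLrcJetKernel2

/-!
# Line `lrc-jet` of crux K2 `PoloidalWindowRigidity` — kernel replay of the exact jet certificate, part 3: the UNSTEADY scheme

Cell ns-regularity-ideate, seat ns-poloidal-K2-cert-1, 2026-08-27. Bears on LADDER-NS N0 (route `PoloidalWindowDoor`, crux
stmt-NavierStokesRegularity-19708, line lrc-jet v2, stub `stub_lrcSpatial`).  The unsteady analogue of `…LrcJetKernel` §1 /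
`…LrcJetKernel2` §4: weighted space–time monomials `x^a t^j` (weight of `t` = 2), the row generator `rowGenU2` of the Jacobian of
the weighted jet scheme of `{∂ₜv + (v·∇)v + ∇p − Δv = 0, div v = 0, (curl v)₂ = 0}` at a rational base jet, the single-pass checker
`certCheckU2` and its soundness `dot_eq_zero_of_certCheckU2(_mkY)`.  Conventions (`x₀,x₁` horizontal, `x₂` vertical; monomial
order; unknown/row layout) are those of the seat's exact engine (work/jetcert), cross-checked by `decide +kernel` on its rows.

Monomials of weighted degree `d`: `(a₀,a₁,a₂,j)` with `a₀+a₁+a₂+2j = d`, enumerated by `j = 0..d/2`, then `a₀`, then `a₁`.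
Unknowns at level `n = 2..N`: `δv_i` of weighted degree `n` (`i=0,1,2`, blocks of size `PU n`), then `δp` of degree `n−1`.
Rows at level `n`: `NS_i` (degree `n−2` coefficients of `∂ₜδv_i + (V·∇)δv_i + (δv·∇)V_i + ∂_iδp − Δδv_i`), `DIV`, `POL` (degree `n−1`).

WHAT THIS IS NOT: not a statement about Navier–Stokes regularity; list/linear-algebra bookkeeping for the certificates.
-/

set_option linter.dupNamespace false
set_option autoImplicit false

namespace Summit.NavierStokesRegularity.NavierStokesRegularity.Theorems.PoloidalWindowDoorPoloidalWindowRigidityLrcJetKernelU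

open Summit.NavierStokesRegularity.NavierStokesRegularity.Theorems.PoloidalWindowDoorPoloidalWindowRigidityLrcJetKernel
open Summit.NavierStokesRegularity.NavierStokesRegularity.Theorems.PoloidalWindowDoorPoloidalWindowRigidityLrcJetKernel2

/-- space–time exponent `(a₀,a₁,a₂,j)`. -/
abbrev Mono4 : Type := ℕ × ℕ × ℕ × ℕ

/-- weighted degree `a₀+a₁+a₂+2j`. -/
def wdeg (m : Mono4) : ℕ := m.1 + m.2.1 + m.2.2.1 + 2 * m.2.2.2

/-- number of weighted monomials of degree `d`: `Σ_{j ≤ d/2} P(d−2j)` (fuelled sum). -/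
def PUaux : ℕ → ℕ → ℕ → ℕ
  | 0, _, _ => 0
  | f + 1, d, j => if 2 * j ≤ d then P (d - 2 * j) + PUaux f d (j + 1) else 0

/-- number of weighted monomials of degree `d`. -/
def PU (d : ℕ) : ℕ := PUaux (d + 1) d 0

/-- position of `(a,j)` within its weighted degree: monomials with smaller `j` first, then the spatial position. -/
def posU (m : Mono4) : ℕ :=
  let d := wdeg m
  ((List.range m.2.2.2).map fun j' => P (d - 2 * j')).sum + posOf (m.1, m.2.1, m.2.2.1)

/-- the weighted monomials of degree `d`, in engine order. -/
def monosU (d : ℕ) : List Mono4 :=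
  (List.range (d / 2 + 1)).flatMap fun j => (monos (d - 2 * j)).map fun s => (s.1, s.2.1, s.2.2, j)

/-- the `pos`-th weighted monomial of degree `d`. -/
def monoAtU (d pos : ℕ) : Mono4 := (monosU d).getD pos (0, 0, 0, 0)

/-- offset of level `n` (levels start at 2). -/
def baseU : ℕ → ℕ
  | 0 => 0
  | 1 => 0
  | 2 => 0
  | n + 1 => baseU n + 3 * PU n + PU (n - 1)

/-- global index of the coefficient of `m` (weighted degree `n`) of `δv_i`. -/
def colVU (i n : ℕ) (m : Mono4) : ℕ := baseU n + i * PU n + posU m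
/-- global index of the coefficient of `m` (weighted degree `n'`) of `δp`. -/
def colPU (n' : ℕ) (m : Mono4) : ℕ := baseU (n' + 1) + 3 * PU (n' + 1) + posU m

/-- spatial exponent `k` (`k = 0,1,2`) or the time exponent (`k = 3`). -/
def mget4 (m : Mono4) (k : ℕ) : ℕ :=
  if k = 0 then m.1 else if k = 1 then m.2.1 else if k = 2 then m.2.2.1 else m.2.2.2
/-- add `c` to exponent `k`. -/
def madd4 (m : Mono4) (k c : ℕ) : Mono4 :=
  if k = 0 then (m.1 + c, m.2.1, m.2.2.1, m.2.2.2) else if k = 1 then (m.1, m.2.1 + c, m.2.2.1, m.2.2.2)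
  else if k = 2 then (m.1, m.2.1, m.2.2.1 + c, m.2.2.2) else (m.1, m.2.1, m.2.2.1, m.2.2.2 + c)
/-- componentwise difference. -/
def msub4 (m m' : Mono4) : Mono4 := (m.1 - m'.1, m.2.1 - m'.2.1, m.2.2.1 - m'.2.2.1, m.2.2.2 - m'.2.2.2)
/-- `m' ≤ m` componentwise. -/
def mle4 (m' m : Mono4) : Bool :=
  decide (m'.1 ≤ m.1) && decide (m'.2.1 ≤ m.2.1) && decide (m'.2.2.1 ≤ m.2.2.1) && decide (m'.2.2.2 ≤ m.2.2.2)

/-- unsteady base jet: term lists `(component, exponent, coefficient)`, one list per component, ascending weighted degree. -/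
abbrev JetTermsU3 : Type := List (List (ℕ × Mono4 × ℚ))

/-- decode a global row index of the unsteady scheme. -/
def rowOfIndexUAux : ℕ → ℕ → ℕ → RowD
  | 0, _, _ => (0, 0, 0, 0)
  | fuel + 1, n, r =>
    let R := PU (n - 2); let Q := PU (n - 1)
    if r < 3 * R then (n, 0, r / R, r % R)
    else if r < 3 * R + Q then (n, 1, 0, r - 3 * R)
    else if r < 3 * R + 2 * Q then (n, 2, 0, r - 3 * R - Q)
    else rowOfIndexUAux fuel (n + 1) (r - 3 * R - 2 * Q)

/-- decode a global row index of the unsteady scheme (levels `2..N`). -/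
def rowOfIndexU (N r : ℕ) : RowD := rowOfIndexUAux (N + 1) 2 r

/-- **Row generator of the UNSTEADY scheme** (cf. `rowGen2`): row `(n, kind, i, pos)`. -/
def rowGenU2 (V3 : JetTermsU3) (r : RowD) : SpVec :=
  let n := r.1; let kind := r.2.1; let i := r.2.2.1; let pos := r.2.2.2
  if kind = 0 then
    let m := monoAtU (n - 2) pos
    -- ∂ₜ δv_i
    let dt := [(colVU i n (madd4 m 3 1), (((mget4 m 3 + 1 : ℕ) : ℤ) : ℚ))]
    -- −Δ δv_i
    let lap := (List.range 3).map fun k =>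
      (colVU i n (madd4 m k 2), -((((mget4 m k + 2) * (mget4 m k + 1) : ℕ) : ℤ) : ℚ))
    -- + ∂_i δp
    let pres := [(colPU (n - 1) (madd4 m i 1), (((mget4 m i + 1 : ℕ) : ℤ) : ℚ))]
    -- (V_j ∂_j δv_i)
    let bilA := V3.flatMap fun Vj => (Vj.takeWhile fun t => decide (wdeg t.2.1 + 3 ≤ n)).filterMap fun t =>
      let j := t.1; let m' := t.2.1; let c := t.2.2
      if mle4 m' m then
        some (colVU i (n - 1 - wdeg m') (madd4 (msub4 m m') j 1), c * (((mget4 m j - mget4 m' j + 1 : ℕ) : ℤ) : ℚ))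
      else none
    -- (δv_j ∂_j V_i)
    let bilB := ((V3.getD i []).takeWhile fun t => decide (wdeg t.2.1 + 1 ≤ n)).flatMap fun t =>
      (List.range 3).filterMap fun j =>
        let μ := t.2.1; let c := t.2.2
        if decide (1 ≤ mget4 μ j) then
          let μ' := msub4 μ (madd4 (0, 0, 0, 0) j 1)
          if mle4 μ' m then
            let m' := msub4 (madd4 m j 1) μ
            if decide (2 ≤ wdeg m') then some (colVU j (wdeg m') m', (((mget4 μ j : ℕ) : ℤ) : ℚ) * c) else none
          else none
        else none
    dt ++ lap ++ pres ++ bilA ++ bilB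
  else if kind = 1 then
    let m := monoAtU (n - 1) pos
    (List.range 3).map fun k => (colVU k n (madd4 m k 1), (((mget4 m k + 1 : ℕ) : ℤ) : ℚ))
  else
    let m := monoAtU (n - 1) pos
    [(colVU 1 n (madd4 m 0 1), (((mget4 m 0 + 1 : ℕ) : ℤ) : ℚ)), (colVU 0 n (madd4 m 1 1), -(((mget4 m 1 + 1 : ℕ) : ℤ) : ℚ))]

/-- sorted, scaled rows of an unsteady certificate. -/
def scaledRowsU (V3 : JetTermsU3) (Y : List (RowD × ℚ)) : List SpVec :=
  Y.map fun e => isortAdd (scale e.2 (rowGenU2 V3 e.1))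

/-- total `dot` of the scaled rows. -/
theorem sumDot_scaledRowsU (V3 : JetTermsU3) (δ : ℕ → ℚ) :
    ∀ Y : List (RowD × ℚ), sumDot (scaledRowsU V3 Y) δ = (Y.map fun e => e.2 * dot (rowGenU2 V3 e.1) δ).sum
  | [] => rfl
  | e :: Y => by
    have ih := sumDot_scaledRowsU V3 δ Y
    simp only [scaledRowsU, sumDot, List.map_cons, List.sum_cons] at *
    rw [dot_isortAdd, dot_scale, ih]

/-- **certificate check, unsteady**: `Σ_r y_r J_r = D·c` via the merge tree. -/
def certCheckU2 (F : ℕ) (V3 : JetTermsU3) (Y : List (RowD × ℚ)) (D : ℚ) (c : SpVec) : Bool :=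
  dropZeros (mergeAll 64 F (scaledRowsU V3 Y)) == dropZeros (isortAdd (scale D c))

/-- **Soundness, unsteady.** -/
theorem dot_eq_zero_of_certCheckU2 (F : ℕ) (V3 : JetTermsU3) (Y : List (RowD × ℚ)) (D : ℚ) (c : SpVec)
    (hD : D ≠ 0) (hcheck : certCheckU2 F V3 Y D c = true) (δ : ℕ → ℚ)
    (hJ : ∀ e ∈ Y, dot (rowGenU2 V3 e.1) δ = 0) : dot c δ = 0 := by
  have h : dropZeros (mergeAll 64 F (scaledRowsU V3 Y)) = dropZeros (isortAdd (scale D c)) := by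
    simpa [certCheckU2] using hcheck
  have h1 : dot (mergeAll 64 F (scaledRowsU V3 Y)) δ = D * dot c δ := by
    rw [← dot_dropZeros, h, dot_dropZeros, dot_isortAdd, dot_scale]
  have h2 : dot (mergeAll 64 F (scaledRowsU V3 Y)) δ = 0 := by
    rw [dot_mergeAll, sumDot_scaledRowsU]
    apply List.sum_eq_zero
    intro x hx
    rw [List.mem_map] at hx
    obtain ⟨e, he, rfl⟩ := hx
    rw [hJ e he, mul_zero]
  have : D * dot c δ = 0 := by rw [← h1, h2]
  rcases mul_eq_zero.mp this with h | h
  · exact absurd h hD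
  · exact h

/-- weighted rows from parallel lists (unsteady decoding). -/
def mkYU (N : ℕ) (rows : List ℕ) (w : List ℤ) : List (RowD × ℚ) :=
  (List.zip rows w).map fun e => (rowOfIndexU N e.1, (e.2 : ℚ))

/-- unsteady soundness with rows given by indices. -/
theorem dot_eq_zero_of_certCheckU2_mkY (F N : ℕ) (V3 : JetTermsU3) (rows : List ℕ) (w : List ℤ) (D : ℚ) (c : SpVec)
    (B : ℕ) (hB : rows.all (fun r => decide (r < B)) = true) (hD : D ≠ 0)
    (hcheck : certCheckU2 F V3 (mkYU N rows w) D c = true) (δ : ℕ → ℚ)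
    (hJ : ∀ r, r < B → dot (rowGenU2 V3 (rowOfIndexU N r)) δ = 0) : dot c δ = 0 := by
  refine dot_eq_zero_of_certCheckU2 F V3 (mkYU N rows w) D c hD hcheck δ ?_
  intro e he
  unfold mkYU at he
  rw [List.mem_map] at he
  obtain ⟨p, hp, rfl⟩ := he
  have hmem : p.1 ∈ rows := (List.of_mem_zip hp).1
  have hlt : p.1 < B := of_decide_eq_true (List.all_eq_true.mp hB _ hmem)
  exact hJ _ hlt

/-- unsteady base jet grouped by component, from parallel lists (component-major, ascending weighted degree). -/
def mkVU3 (js : List ℕ) (ex : List Mono4) (num : List ℤ) (den : List ℤ) : JetTermsU3 :=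
  let all := (List.zip js (List.zip ex (List.zip num den))).map fun e => (e.1, e.2.1, Rat.divInt e.2.2.1 e.2.2.2)
  (List.range 3).map fun i => all.filter fun t => t.1 = i

end Summit.NavierStokesRegularity.NavierStokesRegularity.Theorems.PoloidalWindowDoorPoloidalWindowRigidityLrcJetKernelU
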